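import Summits.ResolutionOfSingularities.ResolutionOfSingularities.Theorems.PurelyInseparableDim4LoopCRegion
import Summits.ResolutionOfSingularities.ResolutionOfSingularities.Theorems.PurelyInseparableDim4ScopeBaseChange
import HarnessLib

/-!
# The KILL-CERTIFICATE FORMAT for F4-C-glob ‖ K: a `decide`-able IN-SCOPE TRAP checker
# (cell `res-dim4-pi`, seat res-dim4-p-8 g2; for the B-REGION hunts of eng-w4 g2 j316739 / eng-w5 g2 at `(3,3)`)

[OURS · counted 0 · instrument] Nothing here is a statement about resolution of singularities; resolution in
dimension `≥ 4` / characteristic `p > 0` is NOT proved or refuted by anything in this file, and NO trap is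
exhibited here — the file is the FORMAT a found region must be delivered in.

`TerminatesInScope p q` (F4-C, frame v4, GLOBAL game `Edge`) fails as soon as ONE field of characteristic
`p` carries a non-empty TRAP (`PIDim4.IsTrap`: every Hironaka-permissible coordinate centre answered inside
the set) all of whose states are IN COORDINATE SCOPE (`ScopeBaseChange.not_terminatesInScope_of_inScopeTrap`,
res-dim4-p-14 / p-3).  res-dim4-p-13's `StepKit.trapB` certifies `IsTrap` on presented tables and this seat's
`LoopC.scopeCertB` (`…LoopCRegion`) certifies `InCoordinateScope` by unit-monomial witnesses; this file merely
ZIPS them: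

* `ScopeTrapRows K` — rows `(state, B's moves, in-scope witnesses)`; `rowsOf` forgets the witnesses;
* **`scopeTrapB q T`** `= trapB q (rowsOf T) ∧ every row passes scopeCertB`;
* **`not_terminatesInScope_of_scopeTrapB : scopeTrapB q T = true → T ≠ [] → ¬ TerminatesInScope p q`**
  (over any field of characteristic `p` with decidable equality, e.g. `ZMod p` data and `decide +kernel`),
  and the set-level facts `isTrap_rowsOf`, `inScope_of_mem_trapSet_rowsOf`.

So a kill candidate from the engines' greatest-fixed-point hunts (WORD #43 (b)(1); eng-w4 g2 «bregion-EC»)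
becomes a tree refutation of `TerminatesInScope 3 3` by DATA ALONE: one `def T : ScopeTrapRows (ZMod 3)` and
one `theorem : scopeTrapB 3 T = true := by decide +kernel`.  (LOOP-C itself is NOT such a trap: its region is
closed only against the maximal-dimensional components, `LoopC.loopC_region`.)
bears_on: LADDER-RESOLUTION:D157-DOOR2 (res-dim4-pi · F4-C-glob(3,3) decision · kill-certificate format).
Supports stmt-ResolutionOfSingularities-16155 (helper).
-/

set_option linter.dupNamespace false -- mandated namespace of this single-conjunct summit

noncomputable section

open MvPolynomial Finset

namespace Summit.ResolutionOfSingularities.ResolutionOfSingularities.Theorems.PIDim4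

namespace LoopC

open StepKit
open Literature.AlgebraicGeometry.Resolution

variable {K : Type} [Field K] [DecidableEq K]

/-- Rows of an in-scope trap table: presented state, B's recorded moves, in-scope witnesses. [folklore] -/
abbrev ScopeTrapRows (K : Type) : Type :=
  List (SData 4 K × List (Move K) × List ((Fin 4 → ℕ) × (Fin 4 → ℕ)))

/-- Forget the witnesses: the underlying trap table of res-dim4-p-13's `StepKit.trapB`. [folklore] -/
def rowsOf (T : ScopeTrapRows K) : TrapRows K := T.map fun r => (r.1, r.2.1)

/-- **The in-scope trap checker**: the underlying table is a trap (every permissible coordinate centre at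
every row answered by a legal move inside the table) and every row's state passes `scopeCertB`. [folklore] -/
def scopeTrapB (q : ℕ) (T : ScopeTrapRows K) : Bool :=
  trapB q (rowsOf T) && T.all fun r => scopeCertB q r.1.L r.2.2

/-- The underlying table of a passing in-scope trap table is a trap. [folklore] -/
theorem isTrap_rowsOf {q : ℕ} {T : ScopeTrapRows K} (h : scopeTrapB q T = true) :
    IsTrap q (trapSet (rowsOf T)) := by
  simp only [scopeTrapB, Bool.and_eq_true] at h
  exact isTrap_of_trapB h.1

/-- Every state of a passing in-scope trap table is in coordinate scope. [folklore] -/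
theorem inScope_of_mem_trapSet_rowsOf {q : ℕ} {T : ScopeTrapRows K} (h : scopeTrapB q T = true) :
    ∀ s ∈ trapSet (rowsOf T), InCoordinateScope q s.F := by
  simp only [scopeTrapB, Bool.and_eq_true, List.all_eq_true] at h
  rintro s ⟨sw, hsw, rfl⟩
  simp only [rowsOf, List.mem_map] at hsw
  obtain ⟨r, hr, rfl⟩ := hsw
  exact inCoordinateScope_toState_of_scopeCertB (h.2 r hr)

omit [DecidableEq K] in
/-- A non-empty table presents a non-empty set. [folklore] -/
theorem trapSet_rowsOf_nonempty {T : ScopeTrapRows K} (hne : T ≠ []) : (trapSet (rowsOf T)).Nonempty := by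
  refine trapSet_nonempty ?_
  simpa [rowsOf] using hne

/-- **A passing non-empty in-scope trap table over ONE field of characteristic `p` refutes F4-C
`TerminatesInScope p q`** (GLOBAL game). [folklore] -/
theorem not_terminatesInScope_of_scopeTrapB (p q : ℕ) [CharP K p] {T : ScopeTrapRows K}
    (h : scopeTrapB q T = true) (hne : T ≠ []) : ¬ TerminatesInScope p q :=
  ScopeBaseChange.not_terminatesInScope_of_inScopeTrap (trapSet_rowsOf_nonempty hne) (isTrap_rowsOf h)
    (inScope_of_mem_trapSet_rowsOf h)

/-- And defeats every permissible coordinate rule over that field while staying in scope: for each such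
rule there is an infinite branch of in-scope states. [folklore] -/
theorem exists_inScope_branch_of_scopeTrapB {q : ℕ} {T : ScopeTrapRows K} (h : scopeTrapB q T = true)
    (hne : T ≠ []) (R : CentreRule K) (hR : IsPermissibleRule q R) :
    ∃ c : ℕ → State K, ∀ k, InCoordinateScope q (c k).F ∧ StepRule q R (c k) (c (k + 1)) := by
  have hT := isTrap_rowsOf h
  have hsc := inScope_of_mem_trapSet_rowsOf h
  have key : ∀ s : trapSet (rowsOf T), ∃ s' : trapSet (rowsOf T),
      StepRule q R (s : State K) (s' : State K) := by
    rintro ⟨s, hs⟩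
    obtain ⟨hord, hall⟩ := hT s hs
    have hperm : IsPermissibleCentre q (R s) s.F := hR s ⟨Finset.univ, ⟨Finset.univ_nonempty, hord⟩⟩
    obtain ⟨s', hs', hedge⟩ := hall (R s) hperm
    exact ⟨⟨s', hs'⟩, hperm, hedge⟩
  choose f hf using key
  obtain ⟨s₀, hs₀⟩ := trapSet_rowsOf_nonempty hne
  refine ⟨fun k => ((f^[k] ⟨s₀, hs₀⟩ : trapSet (rowsOf T)) : State K),
    fun k => ⟨hsc _ (f^[k] ⟨s₀, hs₀⟩).2, ?_⟩⟩
  show StepRule q R ((f^[k] ⟨s₀, hs₀⟩ : trapSet (rowsOf T)) : State K)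
    ((f^[k + 1] ⟨s₀, hs₀⟩ : trapSet (rowsOf T)) : State K)
  rw [Function.iterate_succ_apply']
  exact hf _

end LoopC

end Summit.ResolutionOfSingularities.ResolutionOfSingularities.Theorems.PIDim4

end
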